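import Summits.QuantumAdvantage.QuantumAdvantage.Statement
import Summits.QuantumAdvantage.QuantumAdvantage.Theorems.SoloBlindCeiling
import Literature.Barriers.PneNP.LocalityProofs
import Literature.Computability.MetaComplexity.SmolenskyModq
import Literature.Computability.Complexity.ConstantDepth
import HarnessLib

/-!
# The fan-out (constant-depth) ladder below `QuantumAdvantage`

Solo/blind wall, §1n (v11). Clause (γ) of the typed open core (v7–v10) said: "constant-depth
methods — single-output constant-depth languages are juntas" (tree `LightConeDecision`), so the
depth ladder carries quantum advantage only for relations / promise problems. That is true for
bounded fan-in quantum circuits WITHOUT fan-out (`QNC⁰`), and INCOMPLETE: once the quantum side has the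
unbounded FAN-OUT gate `|b, y₁, …, y_k⟩ ↦ |b, y₁ ⊕ b, …, y_k ⊕ b⟩` (classically free: copying), constant
depth decides PARITY exactly — fan-out conjugated by a layer of Hadamards IS parity (Moore 1999;
Høyer–Špalek 2005, Ex. 1; the two-qubit identity is `soloBlind_hadamard_cnot_duality` below) — and,
with bounded error (Høyer–Špalek 2005) and even exactly (Takahashi–Tani 2013, Thm. 1: `OR_n` in
depth `O(1)`, whence `QNC⁰_f = QAC⁰_f = QTC⁰_f`), every `TC⁰` language. Against the CLASSICAL
constant-depth classes the tree's own lower bounds then give LANGUAGE-level, uniform-vs-non-uniform,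
exact-vs-bounded-error, unconditional quantum-advantage theorems:

* `soloBlind_depthRung_AC0`: any class `Q ∋ PARITY` (e.g. exact `QNC⁰_f`) satisfies `¬ Q ⊆ AC0`
  (`PARITY_not_mem_AC0`, Furst–Saxe–Sipser / Ajtai / Håstad — proved in the tree);
* `soloBlind_depthRung_AC0Mod`: `¬ Q ⊆ AC0Mod p` for every odd prime `p` (Smolensky 1987, tree
  theorem `Smolensky1987_modq_not_mem_AC0Mod_holds.parity_not_mem`); in print this is Green–Homer–
  Moore–Pollett 2002 ("`QACC[q]` is strictly more powerful than its classical counterpart, as is `QAC⁰`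
  when fanout is allowed");
* `soloBlind_depthRung_ACC0_iff`: for `Q ⊇ TC0` the next rung `¬ Q ⊆ ACC0` FOLLOWS from the classical
  frontier statement `¬ TC0 ⊆ ACC0` (open since 1987) and fails only if `TC0 ⊆ ACC0`: the ladder is
  CAPPED exactly where classical constant-depth lower bounds are (`MAJORITY ∉ AC⁰[6]` open);
* `soloBlind_depthRung_top`: for `Q ⊆ BQP` (uniform bounded-error `QNC⁰_f ⊆ BQP`) the top rung
  `¬ Q ⊆ BPP` IS (implies) the summit; Høyer–Špalek 2005 §1: "if `B·QNC⁰_f` can be simulated by a BPP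
  machine, then factoring can be done in polynomial time by bounded-error Turing machines".

The quantum class is a PARAMETER `Q : Set (Language Bool)` with the cited memberships as hypotheses:
the tree has no constant-depth quantum circuit classes with unbounded-arity gates, and positing them
here would smuggle a definition into a Theorems file. What is kernel-checked is (i) the classical
engines by name, (ii) the logical shape of the ladder (theorem-rungs, cap, top = summit), (iii) the
Hadamard duality that makes the quantum side escape junta-hood. FAIRNESS (prose, wall §1n): the
classical dual of fan-out is the parity GATE, so the "fair" pairing without fan-out, `QAC⁰` vs `AC⁰`,
is open in BOTH directions ("is PARITY ∈ QAC⁰?", Moore 1999; Fang–Fenner–Green–Homer–Zhang 2003;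
Nadimpalli–Parham–Vasconcelos–Yuen 2024; Anshu–Dong–Ou–Yao 2025), while WITH the dual granted to the
classical side (`AC⁰[2]`) the theorem-rung survives one step (`MAJORITY ∈ QNC⁰_f ∖ AC⁰[2]`, Razborov
1987) and dies at `ACC⁰`/`TC⁰`. Nothing here is progress towards the summit: it re-types clause (γ).

References: C. Moore, *Quantum circuits: fanout, parity, and counting*, quant-ph/9903046 (1999);
F. Green, S. Homer, C. Moore, C. Pollett, QIC 2 (2002) 35–65, quant-ph/0106017; P. Høyer, R. Špalek,
STACS 2003 / Theory of Computing 1 (2005) 81–103, quant-ph/0208043, §1 and Ex. 1; Y. Takahashi,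
S. Tani, CCC 2013 / comput. complexity 25 (2016), arXiv:1112.6063, Thm. 1; M. Fang, S. Fenner,
F. Green, S. Homer, Y. Zhang, QIC 6 (2006), quant-ph/0312208; S. Nadimpalli, N. Parham,
F. Vasconcelos, H. Yuen, STOC 2024, arXiv:2311.09631; A. Anshu, Y. Dong, F. Ou, P. Yao, STOC 2025,
arXiv:2410.06499; J. Håstad, STOC 1986, Thm. 1; R. Smolensky, STOC 1987, Thm. 2; A. Razborov,
Math. Notes 41 (1987).
-/

namespace Summit.QuantumAdvantage.QuantumAdvantage.Theorems

open Literature.Computability.Complexity Literature.Computability.Cryptography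
  Literature.Computability.QuantumComplexity Literature.Computability.MetaComplexity
  Literature.Barriers.PneNP

/-! ### §1. The Hadamard duality (Moore 1999): fan-out is parity in the conjugate basis -/

/-- The unnormalised two-qubit Hadamard layer `K = H ⊗ H` with `H = [[1,1],[1,-1]]` (so `K * K = 4`),
basis order `|q₀ q₁⟩ ↦ 2q₀ + q₁`. -/
def hadamardLayer₂ : Matrix (Fin 4) (Fin 4) ℤ :=
  !![1, 1, 1, 1; 1, -1, 1, -1; 1, 1, -1, -1; 1, -1, -1, 1]

/-- `CNOT` with control `q₀`, target `q₁` (the one-target fan-out gate). -/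
def cnot₀₁ : Matrix (Fin 4) (Fin 4) ℤ :=
  !![1, 0, 0, 0; 0, 1, 0, 0; 0, 0, 0, 1; 0, 0, 1, 0]

/-- `CNOT` with control `q₁`, target `q₀` (the one-input parity gate onto `q₀`). -/
def cnot₁₀ : Matrix (Fin 4) (Fin 4) ℤ :=
  !![1, 0, 0, 0; 0, 0, 0, 1; 0, 0, 1, 0; 0, 1, 0, 0]

/-- `K * K = 4 • 1`: the layer is a scaled involution (so conjugation by `K/2` is a genuine change
of basis). -/
theorem soloBlind_hadamardLayer₂_sq : hadamardLayer₂ * hadamardLayer₂ = (4 : ℤ) • 1 := by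
  ext i j
  fin_cases i <;> fin_cases j <;>
    simp [hadamardLayer₂, Matrix.mul_apply, Fin.sum_univ_four]

/-- **Hadamard duality** (Moore 1999; Høyer–Špalek 2005, Ex. 1: "if a controlled-not gate is preceded
and succeeded by Hadamard gates on both qubits, it just turns around"): `(H⊗H)·CNOT₀₁·(H⊗H) = CNOT₁₀`,
in unnormalised integer form `K · CNOT₀₁ · K = 4 · CNOT₁₀`. Since the `k` CNOTs of a fan-out gate
share the control and commute, conjugating the fan-out gate by a Hadamard layer on all `k + 1` wires
turns it into the parity gate `|b, y⟩ ↦ |b ⊕ ⨁ yᵢ, y⟩` — depth 3, exact: the reason single-output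
constant-depth quantum circuits WITH fan-out are not juntas. -/
theorem soloBlind_hadamard_cnot_duality :
    hadamardLayer₂ * cnot₀₁ * hadamardLayer₂ = (4 : ℤ) • cnot₁₀ := by
  ext i j
  fin_cases i <;> fin_cases j <;>
    simp [hadamardLayer₂, cnot₀₁, cnot₁₀, Matrix.mul_apply, Fin.sum_univ_four]

/-- The dual reading: conjugation also turns the parity gate back into fan-out. -/
theorem soloBlind_hadamard_cnot_duality' :
    hadamardLayer₂ * cnot₁₀ * hadamardLayer₂ = (4 : ℤ) • cnot₀₁ := by
  ext i j
  fin_cases i <;> fin_cases j <;>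
    simp [hadamardLayer₂, cnot₀₁, cnot₁₀, Matrix.mul_apply, Fin.sum_univ_four]

/-! ### §2. The theorem-rungs: classical constant-depth lower bounds the quantum side does not share -/

/-- **Rung `AC⁰`** (theorem). Any class of languages containing `PARITY` — in particular the languages
decided exactly by constant-depth, polynomial-size quantum circuits with unbounded fan-out, `QNC⁰_f`
(Moore 1999; Høyer–Špalek 2005 Ex. 1; §1) — is not contained in `AC0` (non-uniform, hence a fortiori
not in uniform or randomized `AC⁰`). Engine: the switching lemma (tree: `PARITY_not_mem_AC0`). The
classical bounded-fan-in constant-depth circuits WITH free fan-out decide only juntas (tree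
`Circuit.card_lightCone_le`), so this bound is NOT inherited from the classical part of the model. -/
theorem soloBlind_depthRung_AC0 {Q : Set (Language Bool)} (hPar : PARITY ∈ Q) : ¬ Q ⊆ AC0 :=
  fun h => PARITY_not_mem_AC0 (h hPar)

/-- **Rung `AC⁰[p]`, `p` an odd prime** (theorem; in print Green–Homer–Moore–Pollett 2002, abstract:
"`QACC[q]` is strictly more powerful than its classical counterpart, as is `QAC⁰` when fanout is
allowed"). Engine: Razborov–Smolensky (tree: `Smolensky1987_modq_not_mem_AC0Mod_holds.parity_not_mem`).
For `p = 2` the witness is MAJORITY (`TC⁰ ⊆ QNC⁰_f`, Høyer–Špalek 2005 + Takahashi–Tani 2013 Thm. 1;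
`MAJORITY ∉ AC⁰[2]`, Razborov 1987) — prose only: the tree's `smolensky_majority` is circuit-level. -/
theorem soloBlind_depthRung_AC0Mod {Q : Set (Language Bool)} (hPar : PARITY ∈ Q) {p : ℕ}
    (hp : p.Prime) (hp2 : p ≠ 2) : ¬ Q ⊆ AC0Mod p :=
  fun h => Smolensky1987_modq_not_mem_AC0Mod_holds.parity_not_mem hp hp2 (h hPar)

/-! ### §3. The cap: from `ACC⁰` on, the rung is the classical constant-depth frontier -/

/-- **Rung `ACC⁰`** (open). For a class `Q ⊇ TC0` (bounded-error `QNC⁰_f`, Høyer–Špalek 2005; exact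
`QNC⁰_f`, Takahashi–Tani 2013) the rung `¬ Q ⊆ ACC0` follows from the CLASSICAL frontier statement
`¬ TC0 ⊆ ACC0` — open since Smolensky 1987 (`MAJORITY ∉ AC⁰[6]`?) — and no quantum input is used. -/
theorem soloBlind_depthRung_ACC0_of_frontier {Q : Set (Language Bool)} (hTC : TC0 ⊆ Q)
    (hfront : ¬ TC0 ⊆ ACC0) : ¬ Q ⊆ ACC0 :=
  fun h => hfront (hTC.trans h)

/-- Conversely the rung can fail only in the world `TC0 ⊆ ACC0`; i.e. for `Q ⊇ TC0`,
`¬ Q ⊆ ACC0 ↔ (¬ TC0 ⊆ ACC0) ∨ (∃ L ∈ Q, L ∉ ACC0 ∧ L ∉ TC0)` — either the classical frontier falls or a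
GENUINELY QUANTUM constant-depth language outside `TC⁰` is exhibited (no candidate LANGUAGE is known:
the `QNC⁰_f` algorithms beyond `TC⁰` — approximate QFT, the quantum part of Shor — are sampling /
promise subroutines; wall §1n(iv)). -/
theorem soloBlind_depthRung_ACC0_iff {Q : Set (Language Bool)} (hTC : TC0 ⊆ Q) :
    ¬ Q ⊆ ACC0 ↔ (¬ TC0 ⊆ ACC0) ∨ (∃ L ∈ Q, L ∉ ACC0 ∧ L ∉ TC0) := by
  constructor
  · intro h
    by_cases hT : TC0 ⊆ ACC0
    · right
      by_contra hne
      apply h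
      intro L hL
      by_contra hLA
      by_cases hLT : L ∈ TC0
      · exact hLA (hT hLT)
      · exact hne ⟨L, hL, hLA, hLT⟩
    · exact Or.inl hT
  · rintro (hT | ⟨L, hL, hLA, -⟩)
    · exact soloBlind_depthRung_ACC0_of_frontier hTC hT
    · exact fun h => hLA (h hL)

/-! ### §4. The top: against `BPP` the rung is the summit -/

/-- **Top rung.** For a class `Q ⊆ BQP` — uniform bounded-error `QNC⁰_f` is one (a uniform
constant-depth poly-size family over Clifford+T plus fan-out compiles into a uniform poly-size
Clifford+T family, fan-out being `k` CNOTs) — the rung `¬ Q ⊆ BPP` implies `QuantumAdvantage`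
(and for `Q = BQP` is equivalent to it, `soloBlind_quantumAdvantage_iff_not_subset`). Høyer–Špalek
2005 §1: "if `B·QNC⁰_f` can be simulated by a BPP machine, then factoring can be done in polynomial time
by bounded-error Turing machines" — so this rung, like the summit, sits below `FACTORING ∉ BPP`. -/
theorem soloBlind_depthRung_top {Q : Set (Language Bool)} (hQ : Q ⊆ BQP) (h : ¬ Q ⊆ BPP) :
    _root_.QuantumAdvantage := by
  rw [soloBlind_quantumAdvantage_iff_not_subset]
  exact fun hB => h (hQ.trans hB)

/-- The ladder in one statement: for any `Q` with `PARITY ∈ Q`, `TC0 ⊆ Q`, `Q ⊆ BQP` (the cited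
properties of uniform `QNC⁰_f`, exact or bounded-error), the rungs against `AC0` and `AC0Mod p`
(odd prime `p`) are theorems, the rung against `ACC0` is implied by the classical frontier
`¬ TC0 ⊆ ACC0`, and the rung against `BPP` implies the summit. -/
theorem soloBlind_fanout_ladder {Q : Set (Language Bool)} (hPar : PARITY ∈ Q) (hTC : TC0 ⊆ Q)
    (hQ : Q ⊆ BQP) :
    (¬ Q ⊆ AC0) ∧ (∀ p : ℕ, p.Prime → p ≠ 2 → ¬ Q ⊆ AC0Mod p) ∧
      (¬ TC0 ⊆ ACC0 → ¬ Q ⊆ ACC0) ∧ (¬ Q ⊆ BPP → _root_.QuantumAdvantage) :=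
  ⟨soloBlind_depthRung_AC0 hPar, fun _ hp hp2 => soloBlind_depthRung_AC0Mod hPar hp hp2,
    soloBlind_depthRung_ACC0_of_frontier hTC, soloBlind_depthRung_top hQ⟩

end Summit.QuantumAdvantage.QuantumAdvantage.Theorems
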